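import Literature.MathematicalPhysics.QuantumFieldTheory.Balaban1983to89.B9Eq3115KnitLetterYOnto
import Literature.MathematicalPhysics.QuantumFieldTheory.Balaban1983to89.B9B8KnitAveragingClosenessAtCentre

/-!
# `Balaban1983to89.B9Eq3115KnitLetterYRowCloseness` — T. Bałaban, *Propagators for lattice gauge theories in a background field*, Commun. Math. Phys. **99**
# (1985) 389–434 [Balaban1985BackgroundPropagators], (3.12)–(3.13) p. 392, (3.14)–(3.15) p. 393: THE KNIT LETTER `Q(U)` OF (3.115) IS ROW-WISE CLOSE TO PRINT's
# CENTRE-TAXI AVERAGING `Q_Y(U)` OF (3.12), UP TO A ROW-WISE UNITARY RE-BASING, ON THE CLASS (3.35) — member level, every level structure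

statement-level skeleton of published theorems with citation tags; proofs where landed; nothing here is a claim about the Yang–Mills mass gap

THE PRINT.  (3.12)–(3.13) p. 392: `(Q(U)A)(c) = Σ_{x ∈ B(c₋)} L^{−j(d+1)} Σ_{b ⊂ Γ^{st}_x} R(U(Γ_{y,b₋}))A(b)` — an average of parallel transports along contours from
the block centre `y` ([4] (3.40) p. 397: «a shortest contour»); (3.115) p. 419: the linearised composite (knit) averaging `Q(U)D_U = D̄ʲQ′_j` of [5] = Bałaban,
*Averaging operations for lattice gauge theories*, CMP **98** (1985), (15)–(23) pp. 19–21, (120)–(124) p. 36, whose columns are, in the regime (1.7), the flat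
columns of the CORNER-TREE transported field up to `O(α)` ([5] (139)–(147) pp. 39–40, pp. 24–25: the corner axial gauge).  The two transporter families
(corner-tree vs. centre-taxi) differ by `W_ι(b)·T_ι`, `T_ι = U(Γ^{taxi}_{c→x₀})` independent of the fine bond and `W_ι(b)` the holonomy of the closed contour
`c → b₋ → x₀ → c` inside the double block, within `4(d+2)²α` of `1` (cell `lit-balaban` J-B's `B9B8KnitAveragingClosenessAtCentre.norm_loop_sub_one_le`).

WHY THIS FILE (cell `pub-ymgap`, node N06, seat `dag-n06-l` = bundle F7 rows 20–21, gen 36; director-ym ruling №375 «R2-A» (Q as a parameter `𝔮` of def-Y's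
v10 record), dag-n06-j's question I.18750).  Row 17 (`Δ_a^𝔮 > 0`) at the knit letter `𝔮 := QknitY` is derived by PERTURBATION from the straight-contour gap
(`B9Thm311PosDefAveragingSwap`, `B9Eq315QLetterL2SizeFromClosenessY`): the ONE remaining display is the ℓ²-closeness `δ` of `QknitY U` to `QY parBY U` (or to any
row-wise unitary re-basing of it).  THIS FILE supplies that closeness in ROW FORM, at every member of the class (3.35) and every level structure (no
constant-level hypothesis), with an explicit mass-bounded, level-windowed kernel; dag-n06-j converts it to the `trIP` currency.

THE ROAD.  (i) F8 (`B9Eq3115KnitLetterYOnto`) §3: `(Q(U)a)(ι) = L^{−j}(LʲQ_j(Û_ι)a♯)(z_ι, κ)` at the retraction `Û_ι` of `U♯` to the double box of `ι`, which is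
`α₀′L^{−2j}`-regular everywhere (F5, [5] Prop. 2); (ii) F8 §1 (the ℓ¹ row theorem): `LʲQ_j(Û_ι)B(z,κ)` is the flat average of the corner-tree transported field
`Σ_{s ⊂ box} LʲQ_j(1)(R(Û_ι(Γ^{tree}_{x₀,s₋}))B(s)δ_s)` up to `K(d+1,L)·α₀′·Lʲ·L^{−j(d+1)}·Σ_{s ⊂ box}‖B(s)‖`; (iii) §2 here: that flat average IS `Lʲ·Σ_f q_ι(f)·R(T^{box}_ι(f))a(f)`
with def-Y's flat kernel `qK` and the corner-tree table `boxT` read on the double box (bond-averaging dictionary `linQIter_liftBd_eq_sum_qK`); (iv) §4: at every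
pair with `q_ι(f) ≠ 0`, print's transporter `qT parBY U ι f = U(Γ^{taxi}_{c→f₋})` equals `W·U(Γ^{taxi}_{c→x₀})·T^{box}_ι(f)` with `‖W − 1‖ ≤ 4(d+2)²α₀′` (J-B's loop lemma
at `Û_ι`, locality of holonomies inside the box); (v) `‖R(V)X − X‖ ≤ 2‖V − 1‖‖X‖` and the isometry of `R` at unitaries assemble the display.

WHAT IS PROVED (sorry-free).
* §1 (torus bookkeeping, the 2 `def`s): `two_mul_pow_le_sitesPerDir`, `sub_lo_bounds`; `boxT` (the corner-tree transport of `U♯` from the box corner `x₀ = Lʲz_ι` to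
  the in-box lift of a fine bond's source), `boxT_mem`, `val_sub_transl_lo`, ★ `boxT_eq_of_inBox`, `eq_of_transl_eq_of_inBox`; `boxK` (THE BOX KERNEL
  `(Lʲ)^{−(d+1)}·#{s ⊂ box(ι) : s♭ = f}`), `boxK_nonneg`, ★ `sum_boxK_mul_eq` (fibrewise reading), `card_fiber_le_one`, `boxK_le`, ★ `sum_boxK_le` (ROW MASS `≤ 2(d+1)`),
  ★ `iterBlockOf_of_boxK_ne_zero` (LEVEL WINDOW: `f₋` lies in an end block of `ι` — the shape of `B9Eq3132Ineq2142Covariant.ends_of_qwt_ne_zero`, so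
  `B6Ineq2142KLevelV1.lev_ends_bounds` applies verbatim), ★ `sum_filter_lvl_boxK_le` (COLUMN MASS per level `≤ 2(d+1)·((L^{d+1})^J)⁻¹`, the shape of
  `B6IndexBondLayersKLevelV1.sum_qwt_lvl_le`).
* §2 `lo_inBox`, ★ `flat_sum_rot_eq` — the flat re-summation (iii).
* §3 ★★ `norm_QknitY_sub_boxAvg_le` — THE CORNER ROW FORM: `‖(Q(U)a)(ι) − Σ_f q_ι(f)·R(T^{box}_ι(f))a(f)‖ ≤ K(d+1,L)·α₀′·Σ_f boxK ι f·‖a f‖` on (3.35).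
* §4 `R_finset_sum`, `norm_R_sub_self_le` (`‖R(V)X − X‖ ≤ 2‖V − 1‖‖X‖`), `four_mul_pow_le_sitesPerDir` (`4Lʲ ≤ N₀`), ★ `exists_inBox_of_qK_ne_zero` (an averaged fine bond
  has an in-box lift), `embIter_src_eq`; ★★ `norm_qT_parBY_boxT_rebase_sub_one_le` — (iv), the every-level twin of J-B's `norm_qT_parBY_rebase_sub_one_le`;
  ★★ `norm_boxAvg_sub_R_QY_parBY_le` (`‖Σ_f q_ι(f)R(T^{box}_ι(f))a(f) − R(T_ι)((Q_Y(U)a)(ι))‖ ≤ 8(d+2)²α₀′·Σ_f q_ι(f)‖a f‖`).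
* §5 ★★★ `norm_QknitY_sub_R_QY_parBY_le` — THE DISPLAY: `‖(Q(U)a)(ι) − R(T_ι)((Q_Y(U)a)(ι))‖ ≤ α₀′·Σ_f (K(d+1,L)·boxK ι f + 8(d+2)²·q_ι(f))·‖a f‖` with
  `T_ι = U(Γ^{taxi}_{c→x₀})⁻¹ = (parTaxiV U (embIter j ι₋) (0 + Lʲz_ι))⁻¹`, for every member `U` of `(bg9KP … G i).Reg335 c₀ α₀`, `G ≤ U(N)` unit-bounded, `c₀ ≤ 10`,
  `0 ≤ Mα₀`, and x-free numerics `0 < α₀′ ≤ α_Q(d+1,L)`, `K_pl(Mα₀)·L⁴ < α₀′`; `rebase_mem_unitary`, `rebase_mem` (`T_ι` unitary ∕ `G`-valued).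
HONEST SCOPE.  An estimate COMPOSED from landed kernel theorems by name (t2s-1's column theorem through F8's ℓ¹ row theorem, [5] Prop. 2 through F5's retraction
regularity, J-B's loop lemma and taxicab dictionary, t2s-1's bond-averaging dictionary); helper, count-neutral; row 17 ∕ N06 NOT discharged; nothing continuum ∕
OS ∕ mass gap ∕ Clay — the Yang–Mills mass gap is NOT proved here.  NEW file; nothing landed is modified.  No `sorry`, no `axiom`, no `instance`, no `notation`.
-/

noncomputable section

namespace Literature.MathematicalPhysics.QuantumFieldTheory.Balaban1983to89.B9Eq3115KnitLetterYRowCloseness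

open scoped BigOperators
open B7Prop1Explicit renaming Site → LSite
open B7Prop1Explicit (e e_apply boxVec hol treeWord seg hol_append disp disp_seg disp_treeWord U1)
open B7Prop1Local (InBox AgreeOn loK bondHiK add_e_apply hol_treeWord_congr hol_flatMap_seg_congr)
open B7Prop5Flat (BondIn bondsIn mem_bondsIn bump bump_eq_zero_of linQIter_congr restr agreeOn_insCfg_restr boxFinset mem_boxFinset)
open B7Prop5FlatOperator (card_boxFinset_K card_bondsIn_le)
open B7Prop3Flat (insCfg)
open B7Prop2Explicit (pdev avgClosed_unitaryUnits unitaryUnits unitaryUnits_le_U1 hol_mem_of C0 c2')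
open B7Prop4Flat (linQIter)
open B7Prop4GeneralLevels (linCovIter)
open B7Eq78Linearization (conjR conjR_apply conjR_smul)
open B9Eq316AveragingTransposeZd (alphaQ alphaQ_pos Reg17)
open B9B8KnitColumnFlatness (linQIter_finset_sum linQIter_zero' windows_of_alphaQ)
open B9B8KnitColumnGauge (norm_conjR_le_of_unitary)
open B10Eq27TorusAxialLog (transl transl_apply transl_add_e rel transl_rel)
open B4Reflection242 (blk)
open B5Eq118OneStroke (iterBlockOf)
open B6GlobalChartV1 (PV)
open B6KLevelCensusIndexV1 (KIdx kGeo)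
open B6Ineq2142KLevelV1 (lvl)
open B15DeterminingSets (embIter)
open B9B8CarrierDictionary (liftCfg liftCfg_mem liftCfg_apply conjR_eq_R)
open B9B8KnitBondTransfer (liftBd liftBd_apply)
open B9B8KnitBondAvgDictionary (linQIter_liftBd_eq_sum_qK)
open B9B8KnitBondAvgSupport (src_eq_winBase_of_qK_ne_zero dir_eq_of_qK_ne_zero window_winBase)
open B9B8KnitAveragingClosenessAtCorner (embIter_transl_zero liftCfg_isPeriodic)
open B9B8KnitAveragingClosenessAtCentre (parTaxiV_transl norm_loop_sub_one_le)
open B9B8KnitAveragingClosenessOfColumns (norm_R_le_of_mem_unitaryUnits)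
open B9Eq39Adjoint (R R_smul R_add R_sub R_inv_R R_R_inv)
open B9Thm311FlippedBondForms (qK_nonneg)
open B9Eq3115KnitLetterY (zSrc transl_zero_zSrc QknitY QknitY_apply lvl_le')
open B9Eq3115KnitLetterYFarFace (iterBlockOf_transl_zero blk_of_inBox_bond ibond_ext shift_ne_self)
open B9Eq3115KnitLetterYOnto (kCol kCol_nonneg insCfg_restr_eq_sum reg17_univ_of_pdev retrY agreeOn_liftCfg_retrY retrY_mem QknitY_apply_retract
  norm_linCovIter_sub_sum_linQIter_rot_le_sum)
open B9Eq3124HZKnitPairReg335Y (pdev_retract_bond_lt)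
open B9C2FormBoxRegimeY (Kpl)
open B9BackgroundsKLevelV1P (bg9KP mem_of_reg335P)
open Node00

variable {d ℓ : ℕ} {hd : 1 ≤ d + 1} {hL : Odd (ℓ + 1) ∧ 1 < ℓ + 1} {b₀ b₁ : ℝ}

/-! ## §1 Torus bookkeeping: the corner-tree table on the double box, the box kernel and its masses -/

section Torus

variable (i : KIdx d ℓ hd hL b₀ b₁)

/-- `2Lʲ ≤ N₀` for every index level `j ≤ m + K` (the torus has `2L^{m+K}` sites per direction). [cite: Balaban1984PropagatorsII, (2.1) p.224; Balaban1985Averaging, p.24, bookkeeping] -/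
theorem two_mul_pow_le_sitesPerDir (ι : IBondY i) :
    2 * ((((ℓ + 1 : ℕ) : ℤ)) ^ (ι.1.1 : ℕ)) ≤ ((((PV d ℓ i.m i.K hd hL).sitesPerDir 0 : ℕ) : ℤ)) := by
  have hj : (ι.1.1 : ℕ) ≤ i.m + i.K := (lvl_le' i ι).trans i.hk
  have h1 : (ℓ + 1) ^ (ι.1.1 : ℕ) ≤ (ℓ + 1) ^ (i.m + i.K) := Nat.pow_le_pow_right (Nat.succ_pos ℓ) hj
  have h2 : (PV d ℓ i.m i.K hd hL).sitesPerDir 0 = 2 * (ℓ + 1) ^ (i.m + i.K) := by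
    show 2 * (ℓ + 1) ^ (i.m + i.K - 0) = _; rw [Nat.sub_zero]
  rw [h2]; push_cast
  have : (((ℓ + 1 : ℕ) : ℤ)) ^ (ι.1.1 : ℕ) ≤ (((ℓ : ℤ) + 1)) ^ (i.m + i.K) := by exact_mod_cast h1
  push_cast at this
  linarith

/-- a point of the double box `[Lʲz_ι, Lʲz_ι + (Lʲ−1)𝟙 + Lʲe_κ]` is within `2Lʲ − 1 < N₀` of the corner, coordinatewise. [cite: Balaban1985Averaging, p.24 («Bᵏ(c₋) ∪ Bᵏ(c₊)»), bookkeeping] -/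
theorem sub_lo_bounds (ι : IBondY i) {x : LSite (d + 1)}
    (hx : InBox (loK (ℓ + 1) (ι.1.1 : ℕ) (zSrc i ι)) (bondHiK (ℓ + 1) (ι.1.1 : ℕ) (zSrc i ι) ι.1.2.dir) x) (ν : Fin (d + 1)) :
    0 ≤ x ν - loK (ℓ + 1) (ι.1.1 : ℕ) (zSrc i ι) ν ∧
      x ν - loK (ℓ + 1) (ι.1.1 : ℕ) (zSrc i ι) ν < ((((PV d ℓ i.m i.K hd hL).sitesPerDir 0 : ℕ) : ℤ)) := by
  have h2N := two_mul_pow_le_sitesPerDir i ι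
  obtain ⟨h1, h2⟩ := hx ν
  simp only [loK, bondHiK] at h1 h2 ⊢
  push_cast at h1 h2 h2N ⊢
  refine ⟨by linarith, ?_⟩
  have hP : (0 : ℤ) < ((ℓ : ℤ) + 1) ^ (ι.1.1 : ℕ) := by positivity
  split_ifs at h2 <;> linarith

/-- **THE CORNER-TREE TRANSPORT TABLE ON THE DOUBLE BOX** `T^{box}_ι(f) = U♯(Γ^{tree}_{x₀ → x_ι(f₋)})`: `x₀ = Lʲz_ι` the box corner, `x_ι(p) = x₀ + ((p − (0 + x₀)) read in [0, N₀))`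
the in-box integer lift of a fine torus site (t2s-1's column transport; F8's `farT` reads only the source block). [cite: Balaban1985Averaging, (11) p.19, pp.24–25, (139)–(147) pp.39–40; Balaban1985BackgroundPropagators, (3.32) p.395] -/
def boxT {𝔸 : Type} [NormedRing 𝔸] [NormedAlgebra ℂ 𝔸] [CompleteSpace 𝔸] (U : CfgY 𝔸 i) (ι : IBondY i) (f : FBondY i) : 𝔸ˣ :=
  hol (liftCfg U) (loK (ℓ + 1) (ι.1.1 : ℕ) (zSrc i ι))
    (treeWord fun ν => (((f.src ν - transl (0 : Site (PV d ℓ i.m i.K hd hL) 0) (loK (ℓ + 1) (ι.1.1 : ℕ) (zSrc i ι)) ν).val : ℕ) : ℤ))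

/-- the box table is `G`-valued at `G`-valued `U`. [cite: Balaban1985BackgroundPropagators, p.390 («with values in G»), bookkeeping] -/
theorem boxT_mem {𝔸 : Type} [NormedRing 𝔸] [NormedAlgebra ℂ 𝔸] [CompleteSpace 𝔸] {G : Subgroup 𝔸ˣ} {U : CfgY 𝔸 i} (hU : ∀ μ x, U μ x ∈ G)
    (ι : IBondY i) (f : FBondY i) : boxT i U ι f ∈ G :=
  hol_mem_of (fun z μ => liftCfg_mem hU z μ) _ _

/-- the displacement from the corner, read on the torus in `[0, N₀)`, of an in-box integer point IS its integer displacement.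
[cite: Balaban1984PropagatorsI, (1.6) p.18, bookkeeping] -/
theorem val_sub_transl_lo (ι : IBondY i) {x : LSite (d + 1)}
    (hx : InBox (loK (ℓ + 1) (ι.1.1 : ℕ) (zSrc i ι)) (bondHiK (ℓ + 1) (ι.1.1 : ℕ) (zSrc i ι) ι.1.2.dir) x) (ν : Fin (d + 1)) :
    ((((transl (0 : Site (PV d ℓ i.m i.K hd hL) 0) x ν -
        transl (0 : Site (PV d ℓ i.m i.K hd hL) 0) (loK (ℓ + 1) (ι.1.1 : ℕ) (zSrc i ι)) ν).val : ℕ) : ℤ)) =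
      x ν - loK (ℓ + 1) (ι.1.1 : ℕ) (zSrc i ι) ν := by
  obtain ⟨h0, h2⟩ := sub_lo_bounds i ι hx ν
  have h1 : transl (0 : Site (PV d ℓ i.m i.K hd hL) 0) x ν - transl (0 : Site (PV d ℓ i.m i.K hd hL) 0) (loK (ℓ + 1) (ι.1.1 : ℕ) (zSrc i ι)) ν =
      (((x ν - loK (ℓ + 1) (ι.1.1 : ℕ) (zSrc i ι) ν : ℤ)) : ZMod ((PV d ℓ i.m i.K hd hL).sitesPerDir 0)) := by
    rw [transl_apply, transl_apply]; push_cast; ring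
  rw [h1, ZMod.val_intCast, Int.emod_eq_of_lt h0 h2]

/-- ★ **THE BOX TABLE AT AN IN-BOX LIFT**: `T^{box}_ι(⟨0 + x, μ⟩) = U♯(Γ^{tree}_{x₀ → x})` for `x` in the double box. [cite: Balaban1985Averaging, (11) p.19, pp.24–25, bookkeeping] -/
theorem boxT_eq_of_inBox {𝔸 : Type} [NormedRing 𝔸] [NormedAlgebra ℂ 𝔸] [CompleteSpace 𝔸] (U : CfgY 𝔸 i) (ι : IBondY i) {x : LSite (d + 1)}
    (hx : InBox (loK (ℓ + 1) (ι.1.1 : ℕ) (zSrc i ι)) (bondHiK (ℓ + 1) (ι.1.1 : ℕ) (zSrc i ι) ι.1.2.dir) x) (μ : Fin (d + 1)) :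
    boxT i U ι ⟨transl (0 : Site (PV d ℓ i.m i.K hd hL) 0) x, μ⟩ =
      hol (liftCfg U) (loK (ℓ + 1) (ι.1.1 : ℕ) (zSrc i ι)) (treeWord (x - loK (ℓ + 1) (ι.1.1 : ℕ) (zSrc i ι))) := by
  unfold boxT
  congr 2
  funext ν
  rw [Pi.sub_apply]
  exact val_sub_transl_lo i ι hx ν

/-- two in-box integer points with the same torus image are equal. [cite: Balaban1984PropagatorsI, (1.6) p.18, bookkeeping] -/
theorem eq_of_transl_eq_of_inBox (ι : IBondY i) {x x' : LSite (d + 1)}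
    (hx : InBox (loK (ℓ + 1) (ι.1.1 : ℕ) (zSrc i ι)) (bondHiK (ℓ + 1) (ι.1.1 : ℕ) (zSrc i ι) ι.1.2.dir) x)
    (hx' : InBox (loK (ℓ + 1) (ι.1.1 : ℕ) (zSrc i ι)) (bondHiK (ℓ + 1) (ι.1.1 : ℕ) (zSrc i ι) ι.1.2.dir) x')
    (h : transl (0 : Site (PV d ℓ i.m i.K hd hL) 0) x = transl (0 : Site (PV d ℓ i.m i.K hd hL) 0) x') : x = x' := by
  funext ν
  have h1 := val_sub_transl_lo i ι hx ν
  have h2 := val_sub_transl_lo i ι hx' ν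
  rw [h] at h1
  rw [h1] at h2
  linarith

/-- **THE BOX KERNEL** `boxK ι f = (Lʲ)^{−(d+1)}·#{s ⊂ Bʲ(ι₋) ∪ Bʲ(ι₊) : s♭ = f}` — the ℓ¹ row theorem's uniform weight on the bonds of the double box, pushed to the torus
(`#{…} ∈ {0, 1}`, `card_fiber_le_one`). [cite: Balaban1985Averaging, (139)–(147) pp.39–40, p.24; Balaban1985BackgroundPropagators, (3.14)–(3.15) p.393] -/
def boxK (ι : IBondY i) (f : FBondY i) : ℝ :=
  (((((ℓ + 1 : ℕ) : ℝ)) ^ (ι.1.1 : ℕ)) ^ (d + 1))⁻¹ *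
    (((bondsIn (loK (ℓ + 1) (ι.1.1 : ℕ) (zSrc i ι)) (bondHiK (ℓ + 1) (ι.1.1 : ℕ) (zSrc i ι) ι.1.2.dir)).filter fun s =>
      (⟨transl (0 : Site (PV d ℓ i.m i.K hd hL) 0) s.1, s.2⟩ : FBondY i) = f).card : ℝ)

/-- the box kernel is nonnegative. [cite: Balaban1985Averaging, (139) p.39, bookkeeping] -/
theorem boxK_nonneg (ι : IBondY i) (f : FBondY i) : 0 ≤ boxK i ι f := by
  unfold boxK; positivity

/-- ★ **FIBREWISE READING**: `Σ_f boxK ι f·g(f) = (Lʲ)^{−(d+1)}·Σ_{s ⊂ box(ι)} g(s♭)`. [cite: Balaban1985Averaging, (139)–(147) pp.39–40, bookkeeping] -/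
theorem sum_boxK_mul_eq (ι : IBondY i) (g : FBondY i → ℝ) :
    ∑ f, boxK i ι f * g f = (((((ℓ + 1 : ℕ) : ℝ)) ^ (ι.1.1 : ℕ)) ^ (d + 1))⁻¹ *
      ∑ s ∈ bondsIn (loK (ℓ + 1) (ι.1.1 : ℕ) (zSrc i ι)) (bondHiK (ℓ + 1) (ι.1.1 : ℕ) (zSrc i ι) ι.1.2.dir),
        g ⟨transl (0 : Site (PV d ℓ i.m i.K hd hL) 0) s.1, s.2⟩ := by
  classical
  set S := bondsIn (loK (ℓ + 1) (ι.1.1 : ℕ) (zSrc i ι)) (bondHiK (ℓ + 1) (ι.1.1 : ℕ) (zSrc i ι) ι.1.2.dir) with hS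
  set φ : LSite (d + 1) × Fin (d + 1) → FBondY i := fun s => ⟨transl (0 : Site (PV d ℓ i.m i.K hd hL) 0) s.1, s.2⟩ with hφ
  have hfib : ∑ s ∈ S, g (φ s) = ∑ f, ∑ s ∈ S with φ s = f, g (φ s) := (Finset.sum_fiberwise S φ fun s => g (φ s)).symm
  simp only [boxK, mul_assoc, ← Finset.mul_sum]
  congr 1
  rw [hfib]
  refine Finset.sum_congr rfl fun f _ => ?_
  rw [Finset.sum_congr rfl fun s hs => by rw [(Finset.mem_filter.1 hs).2], Finset.sum_const, nsmul_eq_mul]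

/-- at most ONE box bond lies over a given fine bond (the double box is smaller than the torus). [cite: Balaban1984PropagatorsI, (1.6) p.18; Balaban1985Averaging, p.24] -/
theorem card_fiber_le_one (ι : IBondY i) (f : FBondY i) :
    ((bondsIn (loK (ℓ + 1) (ι.1.1 : ℕ) (zSrc i ι)) (bondHiK (ℓ + 1) (ι.1.1 : ℕ) (zSrc i ι) ι.1.2.dir)).filter fun s =>
      (⟨transl (0 : Site (PV d ℓ i.m i.K hd hL) 0) s.1, s.2⟩ : FBondY i) = f).card ≤ 1 := by
  classical
  refine Finset.card_le_one.2 fun s hs s' hs' => ?_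
  obtain ⟨hsS, hsf⟩ := Finset.mem_filter.1 hs
  obtain ⟨hsS', hsf'⟩ := Finset.mem_filter.1 hs'
  have h := hsf.trans hsf'.symm
  have h1 : transl (0 : Site (PV d ℓ i.m i.K hd hL) 0) s.1 = transl (0 : Site (PV d ℓ i.m i.K hd hL) 0) s'.1 := congrArg PBond.src h
  have h2 : s.2 = s'.2 := congrArg PBond.dir h
  exact Prod.ext (eq_of_transl_eq_of_inBox i ι (mem_bondsIn.1 hsS).1 (mem_bondsIn.1 hsS').1 h1) h2

/-- `boxK ι f ≤ (Lʲ)^{−(d+1)}`. [cite: Balaban1985Averaging, (139) p.39, bookkeeping] -/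
theorem boxK_le (ι : IBondY i) (f : FBondY i) : boxK i ι f ≤ (((((ℓ + 1 : ℕ) : ℝ)) ^ (ι.1.1 : ℕ)) ^ (d + 1))⁻¹ := by
  unfold boxK
  have h := (Nat.cast_le (α := ℝ)).2 (card_fiber_le_one i ι f)
  rw [Nat.cast_one] at h
  have hc : 0 ≤ (((((ℓ + 1 : ℕ) : ℝ)) ^ (ι.1.1 : ℕ)) ^ (d + 1))⁻¹ := by positivity
  have := mul_le_mul_of_nonneg_left h hc
  rwa [mul_one] at this

/-- ★ **ROW MASS** `Σ_f boxK ι f ≤ 2(d+1)` (the double box carries `≤ 2(d+1)(Lʲ)^{d+1}` bonds). [cite: Balaban1985Averaging, p.24, (140) p.39; Balaban1985BackgroundPropagators, (3.14) p.393] -/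
theorem sum_boxK_le (ι : IBondY i) : ∑ f, boxK i ι f ≤ 2 * ((d : ℝ) + 1) := by
  have h := sum_boxK_mul_eq i ι fun _ => 1
  simp only [mul_one, Finset.sum_const, nsmul_eq_mul] at h
  rw [h]
  set S := bondsIn (loK (ℓ + 1) (ι.1.1 : ℕ) (zSrc i ι)) (bondHiK (ℓ + 1) (ι.1.1 : ℕ) (zSrc i ι) ι.1.2.dir) with hS
  set Lj : ℝ := (((ℓ + 1 : ℕ) : ℝ)) ^ (ι.1.1 : ℕ) with hLj
  have hLj0 : 0 < Lj := by positivity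
  have hcard := card_bondsIn_le (loK (ℓ + 1) (ι.1.1 : ℕ) (zSrc i ι)) (bondHiK (ℓ + 1) (ι.1.1 : ℕ) (zSrc i ι) ι.1.2.dir)
  rw [card_boxFinset_K, ← hS] at hcard
  have hc : (S.card : ℝ) ≤ 2 * Lj ^ (d + 1) * ((d : ℝ) + 1) := by
    have := (Nat.cast_le (α := ℝ)).2 hcard
    rw [hLj]; push_cast at this ⊢; linarith
  calc (Lj ^ (d + 1))⁻¹ * (S.card : ℝ) ≤ (Lj ^ (d + 1))⁻¹ * (2 * Lj ^ (d + 1) * ((d : ℝ) + 1)) :=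
        mul_le_mul_of_nonneg_left hc (by positivity)
    _ = 2 * ((d : ℝ) + 1) := by field_simp

/-- ★ **THE LEVEL WINDOW OF THE BOX KERNEL**: `boxK ι f ≠ 0 ⟹` the `j(ι)`-block of `f₋` is `ι₋` or `ι₊` (the shape of `ends_of_qwt_ne_zero`; hence by [4] (2.2)–(2.4)
`lvl ι − 1 ≤ lev f₋ ≤ lvl ι`, `B6Ineq2142KLevelV1.lev_ends_bounds`). [cite: Balaban1984PropagatorsII, (2.2)–(2.4) p.224; Balaban1985Averaging, p.24] -/
theorem iterBlockOf_of_boxK_ne_zero {ι : IBondY i} {f : FBondY i} (h : boxK i ι f ≠ 0) :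
    iterBlockOf (ι.1.1 : ℕ) f.src = ι.1.2.src ∨ iterBlockOf (ι.1.1 : ℕ) f.src = ι.1.2.tgt := by
  classical
  have hj : (ι.1.1 : ℕ) ≤ i.m + i.K := (lvl_le' i ι).trans i.hk
  unfold boxK at h
  have hcard : ((bondsIn (loK (ℓ + 1) (ι.1.1 : ℕ) (zSrc i ι)) (bondHiK (ℓ + 1) (ι.1.1 : ℕ) (zSrc i ι) ι.1.2.dir)).filter fun s =>
      (⟨transl (0 : Site (PV d ℓ i.m i.K hd hL) 0) s.1, s.2⟩ : FBondY i) = f) ≠ ∅ := by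
    intro he; apply h; rw [he, Finset.card_empty, Nat.cast_zero, mul_zero]
  obtain ⟨s, hs⟩ := Finset.nonempty_iff_ne_empty.2 hcard
  obtain ⟨hsS, hsf⟩ := Finset.mem_filter.1 hs
  have hx := (mem_bondsIn.1 hsS).1
  rw [← hsf]
  show iterBlockOf (ι.1.1 : ℕ) (transl (0 : Site (PV d ℓ i.m i.K hd hL) 0) s.1) = ι.1.2.src ∨
    iterBlockOf (ι.1.1 : ℕ) (transl (0 : Site (PV d ℓ i.m i.K hd hL) 0) s.1) = ι.1.2.tgt
  rw [iterBlockOf_transl_zero i hj]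
  rcases blk_of_inBox_bond hx with hb | hb
  · left; rw [hb, transl_zero_zSrc]
  · right; rw [hb, transl_add_e, transl_zero_zSrc]; rfl

omit i in
/-- `(x + e_μ) − e_μ = x` on the torus. [folklore] -/
private theorem unshift_shift' {P : Params} {j : ℕ} (x : Site P j) (μ : Fin P.d) : (x.shift μ).unshift μ = x := by
  funext ν
  by_cases h : ν = μ
  · subst h; simp [Site.shift, Site.unshift]
  · simp [Site.shift, Site.unshift, h]

/-- ★ **COLUMN MASS PER LEVEL** `Σ_{lvl ι = J} boxK ι f ≤ 2(d+1)·((L^{d+1})^J)⁻¹`: at most `2(d+1)` index bonds of a level have `f₋` in an end block (level, source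
labels and direction determine an index bond), each contributing `≤ vol_J⁻¹` (the shape of `sum_qwt_lvl_le`). [cite: Balaban1984PropagatorsI, (1.18) p.20; Balaban1984PropagatorsII, (2.3) p.224] -/
theorem sum_filter_lvl_boxK_le (J : ℕ) (f : FBondY i) :
    ∑ ι ∈ Finset.univ.filter (fun ι : IBondY i => lvl i.hN i.D i.hk ι = J), boxK i ι f
      ≤ 2 * ((d : ℝ) + 1) * ((((((ℓ + 1 : ℕ) : ℝ)) ^ (d + 1)) ^ J)⁻¹) := by
  classical
  set F := Finset.univ.filter (fun ι : IBondY i => lvl i.hN i.D i.hk ι = J) with hF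
  set A := F.filter (fun ι => iterBlockOf (ι.1.1 : ℕ) f.src = ι.1.2.src) with hA
  set B := F.filter (fun ι => iterBlockOf (ι.1.1 : ℕ) f.src = ι.1.2.tgt) with hB
  have hlvl : ∀ ι ∈ F, (ι.1.1 : ℕ) = J := fun ι hι => (Finset.mem_filter.1 hι).2
  -- only `A ∪ B` contributes
  have hsub : A ∪ B ⊆ F := Finset.union_subset (Finset.filter_subset _ _) (Finset.filter_subset _ _)
  have hsplit : ∑ ι ∈ F, boxK i ι f = ∑ ι ∈ A ∪ B, boxK i ι f := by
    refine (Finset.sum_subset hsub fun ι hιF hι => ?_).symm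
    by_contra hne
    rcases iterBlockOf_of_boxK_ne_zero i hne with h | h
    · exact hι (Finset.mem_union_left _ (Finset.mem_filter.2 ⟨hιF, h⟩))
    · exact hι (Finset.mem_union_right _ (Finset.mem_filter.2 ⟨hιF, h⟩))
  -- level, source labels and direction determine an index bond: the direction is injective on `A` and on `B`
  have hcardA : A.card ≤ d + 1 := by
    have hinj : Set.InjOn (fun ι : IBondY i => ι.1.2.dir) ↑A := by
      intro ι hι ι' hι' hdir
      obtain ⟨hιF, hι⟩ := Finset.mem_filter.1 (Finset.mem_coe.1 hι)
      obtain ⟨hιF', hι'⟩ := Finset.mem_filter.1 (Finset.mem_coe.1 hι')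
      have hjj : (ι'.1.1 : ℕ) = (ι.1.1 : ℕ) := by rw [hlvl ι hιF, hlvl ι' hιF']
      refine (ibond_ext i hjj (fun μ => ?_) hdir.symm).symm
      rw [← hι, ← hι']
      exact congrArg (fun n : ℕ => ((iterBlockOf n f.src μ).val : ℕ)) hjj
    have h := Finset.card_le_card_of_injOn (fun ι : IBondY i => ι.1.2.dir) (fun _ _ => Finset.mem_univ _) hinj
    simpa using h
  have hcardB : B.card ≤ d + 1 := by
    have hinj : Set.InjOn (fun ι : IBondY i => ι.1.2.dir) ↑B := by
      intro ι hι ι' hι' hdir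
      obtain ⟨hιF, hι⟩ := Finset.mem_filter.1 (Finset.mem_coe.1 hι)
      obtain ⟨hιF', hι'⟩ := Finset.mem_filter.1 (Finset.mem_coe.1 hι')
      have hjj : (ι'.1.1 : ℕ) = (ι.1.1 : ℕ) := by rw [hlvl ι hιF, hlvl ι' hιF']
      have hs : ι.1.2.src = (iterBlockOf (ι.1.1 : ℕ) f.src).unshift ι.1.2.dir := by
        rw [hι]; exact (unshift_shift' _ _).symm
      have hs' : ι'.1.2.src = (iterBlockOf (ι'.1.1 : ℕ) f.src).unshift ι'.1.2.dir := by
        rw [hι']; exact (unshift_shift' _ _).symm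
      refine (ibond_ext i hjj (fun μ => ?_) hdir.symm).symm
      simp only at hdir
      rw [hs, hs', hdir]
      exact congrArg (fun n : ℕ => (((iterBlockOf n f.src).unshift ι'.1.2.dir μ).val : ℕ)) hjj
    have h := Finset.card_le_card_of_injOn (fun ι : IBondY i => ι.1.2.dir) (fun _ _ => Finset.mem_univ _) hinj
    simpa using h
  -- each contributing index bond weighs at most `vol_J⁻¹`
  set vJ : ℝ := ((((((ℓ + 1 : ℕ) : ℝ)) ^ (d + 1)) ^ J)⁻¹) with hvJ
  have hterm : ∀ ι ∈ A ∪ B, boxK i ι f ≤ vJ := by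
    intro ι hι
    have hJ : (ι.1.1 : ℕ) = J := hlvl ι (hsub hι)
    have h := boxK_le i ι f
    rw [hJ, ← pow_mul, mul_comm, pow_mul] at h
    exact h
  have hcardAB : ((A ∪ B).card : ℝ) ≤ 2 * ((d : ℝ) + 1) := by
    have h1 := Finset.card_union_le A B
    have : ((A ∪ B).card : ℝ) ≤ ((A.card + B.card : ℕ) : ℝ) := by exact_mod_cast h1
    have hA' : (A.card : ℝ) ≤ (d : ℝ) + 1 := by exact_mod_cast hcardA
    have hB' : (B.card : ℝ) ≤ (d : ℝ) + 1 := by exact_mod_cast hcardB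
    push_cast at this; linarith
  have hvJ0 : 0 ≤ vJ := by positivity
  calc ∑ ι ∈ F, boxK i ι f = ∑ ι ∈ A ∪ B, boxK i ι f := hsplit
    _ ≤ ∑ ι ∈ A ∪ B, vJ := Finset.sum_le_sum hterm
    _ = (A ∪ B).card * vJ := by rw [Finset.sum_const, nsmul_eq_mul]
    _ ≤ 2 * ((d : ℝ) + 1) * vJ := mul_le_mul_of_nonneg_right hcardAB hvJ0

end Torus

/-! ## §2 The flat part of the ℓ¹ row theorem, re-summed into def-Y's flat kernel and the box table -/

section Flat

open scoped Matrix Matrix.Norms.L2Operator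

variable {N : ℕ} (i : KIdx d ℓ hd hL b₀ b₁)

/-- the box corner lies in the double box. [cite: Balaban1985Averaging, p.24, bookkeeping] -/
theorem lo_inBox (ι : IBondY i) :
    InBox (loK (ℓ + 1) (ι.1.1 : ℕ) (zSrc i ι)) (bondHiK (ℓ + 1) (ι.1.1 : ℕ) (zSrc i ι) ι.1.2.dir) (loK (ℓ + 1) (ι.1.1 : ℕ) (zSrc i ι)) := by
  intro ν
  have hP : (1 : ℤ) ≤ ((ℓ + 1 : ℕ) : ℤ) ^ (ι.1.1 : ℕ) := one_le_pow₀ (by exact_mod_cast Nat.succ_pos ℓ)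
  simp only [loK, bondHiK]
  refine ⟨le_rfl, ?_⟩
  push_cast at hP ⊢
  split_ifs <;> nlinarith

/-- ★ **THE FLAT RE-SUMMATION**: at the retraction `Û_ι`, the flat average of the corner-tree transported lift `a♯` over the box bonds IS
`Lʲ·Σ_f q_ι(f)·R(T^{box}_ι(f))a(f)` — locality of the tree holonomies inside the box (`Û_ι = U♯` there), the flat average sees only the box bonds, and t2s-1's
bond-averaging dictionary `LʲQ_j(1)(G♯)(z_ι, κ) = Lʲ·Σ_f q_ι(f)G(f)`. [cite: Balaban1985Averaging, (139)–(147) pp.39–40, p.24; Balaban1985BackgroundPropagators, (3.12)–(3.13) p.392; Balaban1984PropagatorsI, (1.18) p.20] -/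
theorem flat_sum_rot_eq (U : CfgY (Matrix (Fin N) (Fin N) ℂ) i) (ι : IBondY i) (a : FBondY i → Matrix (Fin N) (Fin N) ℂ) :
    ∑ s ∈ bondsIn (loK (ℓ + 1) (ι.1.1 : ℕ) (zSrc i ι)) (bondHiK (ℓ + 1) (ι.1.1 : ℕ) (zSrc i ι) ι.1.2.dir),
        linQIter (ℓ + 1) (bump s.1 s.2 (conjR (hol (retrY i U ι) (loK (ℓ + 1) (ι.1.1 : ℕ) (zSrc i ι))
          (treeWord (s.1 - loK (ℓ + 1) (ι.1.1 : ℕ) (zSrc i ι)))) (liftBd i a s.1 s.2))) (ι.1.1 : ℕ) (zSrc i ι) ι.1.2.dir =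
      (((((ℓ + 1 : ℕ) : ℝ)) ^ (ι.1.1 : ℕ) : ℝ) : ℂ) • ∑ f, ((qK i ι f : ℝ) : ℂ) • conjR (boxT i U ι f) (a f) := by
  classical
  letI : CStarAlgebra (Matrix (Fin N) (Fin N) ℂ) := {}
  set lo := loK (ℓ + 1) (ι.1.1 : ℕ) (zSrc i ι) with hlo
  set hi := bondHiK (ℓ + 1) (ι.1.1 : ℕ) (zSrc i ι) ι.1.2.dir with hhi
  set S := bondsIn lo hi with hS
  set G : FBondY i → Matrix (Fin N) (Fin N) ℂ := fun f => conjR (boxT i U ι f) (a f) with hG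
  -- (A) on a box bond, the corner-tree rotation of `a♯` is the lift of `G`
  have hA : ∀ s ∈ S, bump s.1 s.2 (conjR (hol (retrY i U ι) lo (treeWord (s.1 - lo))) (liftBd i a s.1 s.2)) =
      bump s.1 s.2 (liftBd i G s.1 s.2) := by
    intro s hs
    have hx : InBox lo hi s.1 := (mem_bondsIn.1 hs).1
    have hhol : hol (retrY i U ι) lo (treeWord (s.1 - lo)) = hol (liftCfg U) lo (treeWord (s.1 - lo)) :=
      (hol_treeWord_congr (agreeOn_liftCfg_retrY i U ι) lo (s.1 - lo) (lo_inBox i ι) (by rw [add_sub_cancel]; exact hx)).symm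
    rw [hhol, liftBd_apply, liftBd_apply, hG]
    simp only
    rw [boxT_eq_of_inBox i U ι hx]
  rw [Finset.sum_congr rfl fun s hs => by rw [hA s hs]]
  -- (B) the flat average of the inserted restriction is the flat average of `G♯`
  have hB : ∑ s ∈ S, linQIter (ℓ + 1) (bump s.1 s.2 (liftBd i G s.1 s.2)) (ι.1.1 : ℕ) (zSrc i ι) ι.1.2.dir =
      linQIter (ℓ + 1) (liftBd i G) (ι.1.1 : ℕ) (zSrc i ι) ι.1.2.dir := by
    have h1 : (∑ s ∈ S, linQIter (ℓ + 1) (bump s.1 s.2 (liftBd i G s.1 s.2)) (ι.1.1 : ℕ)) (zSrc i ι) ι.1.2.dir =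
        ∑ s ∈ S, linQIter (ℓ + 1) (bump s.1 s.2 (liftBd i G s.1 s.2)) (ι.1.1 : ℕ) (zSrc i ι) ι.1.2.dir := by
      rw [Finset.sum_apply, Finset.sum_apply]
    have h2 : linQIter (ℓ + 1) (∑ s ∈ S, bump s.1 s.2 (liftBd i G s.1 s.2)) (ι.1.1 : ℕ) =
        ∑ s ∈ S, linQIter (ℓ + 1) (bump s.1 s.2 (liftBd i G s.1 s.2)) (ι.1.1 : ℕ) :=
      linQIter_finset_sum (ℓ + 1) S (fun s => bump s.1 s.2 (liftBd i G s.1 s.2)) (ι.1.1 : ℕ)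
    rw [← h1, ← h2]
    have hins : insCfg S (restr S (liftBd i G)) = ∑ s ∈ S, bump s.1 s.2 (liftBd i G s.1 s.2) := by
      rw [insCfg_restr_eq_sum S (liftBd i G), zero_add]
      exact Finset.sum_congr rfl fun s _ => one_smul _ _
    rw [← hins]
    exact (linQIter_congr (ℓ + 1) (ι.1.1 : ℕ) (zSrc i ι) ι.1.2.dir (agreeOn_insCfg_restr lo hi (liftBd i G))).symm
  rw [hB, linQIter_liftBd_eq_sum_qK i ι (zSrc i ι) (transl_zero_zSrc i ι) G]

end Flat

/-! ## §3 ★★ The corner row form on (3.35) -/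

section Corner

open scoped Matrix Matrix.Norms.L2Operator

variable {N : ℕ} [Nonempty (Fin N)] (i : KIdx d ℓ hd hL b₀ b₁) {G : Subgroup (Matrix (Fin N) (Fin N) ℂ)ˣ}

/-- ★★ **THE CORNER ROW FORM — THE KNIT LETTER IS THE CORNER-TREE TRANSPORTED FLAT AVERAGE UP TO `K·α₀′·(boxK-mass of a)`**: for every member background `U`
of the class `(bg9KP …).Reg335 c₀ α₀` (`G ≤ U(N)` unit-bounded, `c₀ ≤ 10`, `0 ≤ Mα₀`), x-free numerics `0 < α₀′ ≤ α_Q(d+1,L)`, `K_pl(Mα₀)·L⁴ < α₀′`, every bond function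
`a` and every index bond `ι`: `‖(Q(U)a)(ι) − Σ_f q_ι(f)·R(T^{box}_ι(f))a(f)‖ ≤ K(d+1,L)·α₀′·Σ_f boxK ι f·‖a(f)‖`
(F8's retraction formula + ℓ¹ row theorem at `Û_ι` + §2's re-summation). [cite: Balaban1985BackgroundPropagators, (3.12)–(3.13) p.392, (3.115) p.419, (3.35) p.396; Balaban1985Averaging, (139)–(147) pp.39–40, Prop. 2 p.26] -/
theorem norm_QknitY_sub_boxAvg_le (hG1 : ∀ u : (Matrix (Fin N) (Fin N) ℂ)ˣ, u ∈ G → ‖(u : Matrix (Fin N) (Fin N) ℂ)‖ ≤ 1)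
    (hGU : G ≤ unitaryUnits (Matrix (Fin N) (Fin N) ℂ))
    {U : CfgY (Matrix (Fin N) (Fin N) ℂ) i} {c₀ α₀ : ℝ} (hc : c₀ ≤ 10) (hMα : 0 ≤ (kGeo i).M * α₀)
    (hreg : (bg9KP (Matrix (Fin N) (Fin N) ℂ) G i).Reg335 c₀ α₀ U) {α₀' : ℝ} (hα' : 0 < α₀') (hαQ : α₀' ≤ alphaQ (d + 1) (ℓ + 1))
    (hK : Kpl i ((kGeo i).M * α₀) * (kGeo i).L ^ 4 < α₀') (a : FBondY i → Matrix (Fin N) (Fin N) ℂ) (ι : IBondY i) :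
    ‖QknitY i U a ι - ∑ f, ((qK i ι f : ℝ) : ℂ) • conjR (boxT i U ι f) (a f)‖ ≤ kCol (d + 1) (ℓ + 1) * α₀' * ∑ f, boxK i ι f * ‖a f‖ := by
  classical
  letI : CStarAlgebra (Matrix (Fin N) (Fin N) ℂ) := {}
  have hL1 : 1 ≤ ℓ + 1 := Nat.succ_pos ℓ
  have hL2 : 2 ≤ ℓ + 1 := hL.2
  have hD : 1 ≤ d + 1 := Nat.succ_pos d
  obtain ⟨hα3, hα2, -⟩ := windows_of_alphaQ (D := d + 1) hL2 hD hα' hαQ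
  have hU : ∀ μ x, U μ x ∈ unitaryUnits (Matrix (Fin N) (Fin N) ℂ) := fun μ x => hGU (mem_of_reg335P (G := G) i hreg μ x)
  have hVu : ∀ x μ, retrY i U ι x μ ∈ unitaryUnits (Matrix (Fin N) (Fin N) ℂ) := retrY_mem i hU ι
  have h52 : pdev (retrY i U ι) < α₀' * ((((ℓ + 1 : ℕ) : ℝ) ^ (ι.1.1 : ℕ))⁻¹) ^ 2 := pdev_retract_bond_lt i hG1 U hc hMα hreg hK ι
  have hreg17 : Reg17 (ℓ + 1) (ι.1.1 : ℕ) (fun _ => (Set.univ : Set (LSite (d + 1)))) α₀' (retrY i U ι) :=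
    reg17_univ_of_pdev hL1 hα'.le hVu (by exact_mod_cast h52)
  set Lj : ℝ := (((ℓ + 1 : ℕ) : ℝ)) ^ (ι.1.1 : ℕ) with hLj
  have hLj0 : 0 < Lj := by positivity
  set B := liftBd i a with hB
  set lo := loK (ℓ + 1) (ι.1.1 : ℕ) (zSrc i ι) with hlo
  set S := bondsIn lo (bondHiK (ℓ + 1) (ι.1.1 : ℕ) (zSrc i ι) ι.1.2.dir) with hS
  set main := linCovIter (ℓ + 1) (retrY i U ι) B (ι.1.1 : ℕ) (zSrc i ι) ι.1.2.dir with hmain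
  set flat := ∑ s ∈ S, linQIter (ℓ + 1) (bump s.1 s.2 (conjR (hol (retrY i U ι) lo (treeWord (s.1 - lo))) (B s.1 s.2)))
    (ι.1.1 : ℕ) (zSrc i ι) ι.1.2.dir with hflat
  set avg := ∑ f, ((qK i ι f : ℝ) : ℂ) • conjR (boxT i U ι f) (a f) with havg
  have hflatY : flat = ((Lj : ℝ) : ℂ) • avg := by rw [hflat, hB, hS, hlo, hLj, havg]; exact flat_sum_rot_eq i U ι a
  -- `Q(U)a(ι) − avg = Lʲ⁻¹ • (main − flat)`
  have hrow := norm_linCovIter_sub_sum_linQIter_rot_le_sum (D := d + 1) hL2 hD hα' hαQ hVu hreg17 (zSrc i ι) ι.1.2.dir B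
  have hDY : QknitY i U a ι - avg = (((Lj⁻¹ : ℝ)) : ℂ) • (main - flat) := by
    rw [QknitY_apply_retract i hG1 hGU U hc hMα hreg hα' hα3 hα2 hK a ι, smul_sub, hflatY, smul_smul, ← Complex.ofReal_mul,
      inv_mul_cancel₀ hLj0.ne', Complex.ofReal_one, one_smul]
  rw [hDY, norm_smul, Complex.norm_real, Real.norm_of_nonneg (by positivity)]
  -- the ℓ¹ mass of `a♯` on the box is `(Lʲ)^{d+1}·Σ_f boxK ι f‖a f‖`
  have hmass : ∑ s ∈ S, ‖B s.1 s.2‖ = Lj ^ (d + 1) * ∑ f, boxK i ι f * ‖a f‖ := by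
    have h := sum_boxK_mul_eq i ι fun f => ‖a f‖
    rw [h, ← mul_assoc, mul_inv_cancel₀ (by positivity), one_mul, hB]
    exact Finset.sum_congr rfl fun s _ => by rw [liftBd_apply]
  have h1 : ‖main - flat‖ ≤ kCol (d + 1) (ℓ + 1) * α₀' * (Lj * ((Lj ^ (d + 1))⁻¹)) * (Lj ^ (d + 1) * ∑ f, boxK i ι f * ‖a f‖) := by
    have h := hrow
    rw [hmass] at h
    simpa only [hLj, Nat.cast_pow] using h
  have hsum0 : 0 ≤ ∑ f, boxK i ι f * ‖a f‖ := Finset.sum_nonneg fun f _ => mul_nonneg (boxK_nonneg i ι f) (norm_nonneg _)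
  have hk0 := kCol_nonneg (d + 1) (ℓ + 1)
  calc Lj⁻¹ * ‖main - flat‖ ≤ Lj⁻¹ * (kCol (d + 1) (ℓ + 1) * α₀' * (Lj * ((Lj ^ (d + 1))⁻¹)) * (Lj ^ (d + 1) * ∑ f, boxK i ι f * ‖a f‖)) :=
        mul_le_mul_of_nonneg_left h1 (by positivity)
    _ = kCol (d + 1) (ℓ + 1) * α₀' * ∑ f, boxK i ι f * ‖a f‖ := by
        have hP : Lj ^ (d + 1) ≠ 0 := by positivity
        field_simp

end Corner

/-! ## §4 Re-basing the corner-tree table to print's centre-taxi table, at every level structure -/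

section Radj

open scoped Matrix Matrix.Norms.L2Operator

variable {N : ℕ}

/-- `R(V)` is additive over finite sums. [cite: Balaban1985BackgroundPropagators, (3.28) p.395, bookkeeping] -/
theorem R_finset_sum {X : Type} (V : (Matrix (Fin N) (Fin N) ℂ)ˣ) (s : Finset X) (g : X → Matrix (Fin N) (Fin N) ℂ) :
    R V (∑ x ∈ s, g x) = ∑ x ∈ s, R V (g x) := by
  classical
  induction s using Finset.induction_on with
  | empty => rw [Finset.sum_empty, Finset.sum_empty, B9Eq39Adjoint.R_zero]
  | insert a s ha ih => rw [Finset.sum_insert ha, Finset.sum_insert ha, R_add, ih]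

variable [Nonempty (Fin N)]

/-- `‖R(V)X − X‖ ≤ 2‖V − 1‖·‖X‖` for `V` with `‖V‖, ‖V⁻¹‖ ≤ 1`. [cite: Balaban1985BackgroundPropagators, (3.28) p.395, bookkeeping] -/
theorem norm_R_sub_self_le {V : (Matrix (Fin N) (Fin N) ℂ)ˣ} (hV : V ∈ U1 (Matrix (Fin N) (Fin N) ℂ)) (X : Matrix (Fin N) (Fin N) ℂ) :
    ‖R V X - X‖ ≤ 2 * ‖(V : Matrix (Fin N) (Fin N) ℂ) - 1‖ * ‖X‖ := by
  have h : R V X - X = ((V : Matrix (Fin N) (Fin N) ℂ) - 1) * X * ((V⁻¹ : (Matrix (Fin N) (Fin N) ℂ)ˣ) : Matrix (Fin N) (Fin N) ℂ) +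
      X * (((V⁻¹ : (Matrix (Fin N) (Fin N) ℂ)ˣ) : Matrix (Fin N) (Fin N) ℂ) - 1) := by
    rw [B9Eq39Adjoint.R_def]; noncomm_ring
  have hinv : ‖((V⁻¹ : (Matrix (Fin N) (Fin N) ℂ)ˣ) : Matrix (Fin N) (Fin N) ℂ) - 1‖ ≤ ‖(V : Matrix (Fin N) (Fin N) ℂ) - 1‖ := by
    have e : ((V⁻¹ : (Matrix (Fin N) (Fin N) ℂ)ˣ) : Matrix (Fin N) (Fin N) ℂ) - 1 =
        ((V⁻¹ : (Matrix (Fin N) (Fin N) ℂ)ˣ) : Matrix (Fin N) (Fin N) ℂ) * (1 - (V : Matrix (Fin N) (Fin N) ℂ)) := by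
      rw [mul_sub, mul_one, Units.inv_mul]
    rw [e]
    calc ‖((V⁻¹ : (Matrix (Fin N) (Fin N) ℂ)ˣ) : Matrix (Fin N) (Fin N) ℂ) * (1 - (V : Matrix (Fin N) (Fin N) ℂ))‖
        ≤ ‖((V⁻¹ : (Matrix (Fin N) (Fin N) ℂ)ˣ) : Matrix (Fin N) (Fin N) ℂ)‖ * ‖1 - (V : Matrix (Fin N) (Fin N) ℂ)‖ := norm_mul_le _ _
      _ ≤ 1 * ‖1 - (V : Matrix (Fin N) (Fin N) ℂ)‖ := mul_le_mul_of_nonneg_right hV.2 (norm_nonneg _)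
      _ = ‖(V : Matrix (Fin N) (Fin N) ℂ) - 1‖ := by rw [one_mul, norm_sub_rev]
  rw [h]
  calc ‖((V : Matrix (Fin N) (Fin N) ℂ) - 1) * X * ((V⁻¹ : (Matrix (Fin N) (Fin N) ℂ)ˣ) : Matrix (Fin N) (Fin N) ℂ) +
        X * (((V⁻¹ : (Matrix (Fin N) (Fin N) ℂ)ˣ) : Matrix (Fin N) (Fin N) ℂ) - 1)‖
      ≤ ‖(V : Matrix (Fin N) (Fin N) ℂ) - 1‖ * ‖X‖ * ‖((V⁻¹ : (Matrix (Fin N) (Fin N) ℂ)ˣ) : Matrix (Fin N) (Fin N) ℂ)‖ +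
        ‖X‖ * ‖((V⁻¹ : (Matrix (Fin N) (Fin N) ℂ)ˣ) : Matrix (Fin N) (Fin N) ℂ) - 1‖ := by
        refine (norm_add_le _ _).trans (add_le_add ?_ (norm_mul_le _ _))
        exact (norm_mul_le _ _).trans (mul_le_mul_of_nonneg_right (norm_mul_le _ _) (norm_nonneg _))
    _ ≤ ‖(V : Matrix (Fin N) (Fin N) ℂ) - 1‖ * ‖X‖ * 1 + ‖X‖ * ‖(V : Matrix (Fin N) (Fin N) ℂ) - 1‖ := by
        gcongr
        · exact hV.2
    _ = 2 * ‖(V : Matrix (Fin N) (Fin N) ℂ) - 1‖ * ‖X‖ := by ring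

end Radj

section Rebase

open scoped Matrix Matrix.Norms.L2Operator

variable {N : ℕ} [Nonempty (Fin N)] (i : KIdx d ℓ hd hL b₀ b₁) {G : Subgroup (Matrix (Fin N) (Fin N) ℂ)ˣ}

omit [Nonempty (Fin N)] in
/-- `4Lʲ ≤ N₀` for `j ≤ k` (the period is `L^{k+1}·M_h·P′₀`, `M_h ≥ 8`, `P′ ≥ 5`) — adapted from `B9Eq359VarParBY.four_mul_pow_le_period`.
[cite: Balaban1984PropagatorsII, (2.1) p.224, bookkeeping] -/
theorem four_mul_pow_le_sitesPerDir (ι : IBondY i) :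
    4 * ((((ℓ + 1 : ℕ) : ℤ)) ^ (ι.1.1 : ℕ)) ≤ ((((PV d ℓ i.m i.K hd hL).sitesPerDir 0 : ℕ) : ℤ)) := by
  have hj : (ι.1.1 : ℕ) ≤ i.k := lvl_le' i ι
  have hnat : 4 * (ℓ + 1) ^ (ι.1.1 : ℕ) ≤ (PV d ℓ i.m i.K hd hL).sitesPerDir 0 := by
    rw [← i.hN 0]
    show 4 * (ℓ + 1) ^ (ι.1.1 : ℕ) ≤ (ℓ + 1) ^ i.k * ((ℓ + 1) * (i.Mh * i.P' 0))
    have h8 : 8 ≤ i.Mh := i.hM8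
    have h5 : 5 ≤ i.P' 0 := i.hP5 0
    have hpow : (ℓ + 1) ^ (ι.1.1 : ℕ) ≤ (ℓ + 1) ^ i.k := Nat.pow_le_pow_right (by omega) hj
    have h40 : 4 ≤ (ℓ + 1) * (i.Mh * i.P' 0) :=
      calc 4 ≤ i.Mh * i.P' 0 := le_trans (by norm_num) (Nat.mul_le_mul h8 h5)
        _ ≤ (ℓ + 1) * (i.Mh * i.P' 0) := Nat.le_mul_of_pos_left _ (Nat.succ_pos ℓ)
    calc 4 * (ℓ + 1) ^ (ι.1.1 : ℕ) = (ℓ + 1) ^ (ι.1.1 : ℕ) * 4 := by ring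
      _ ≤ (ℓ + 1) ^ i.k * ((ℓ + 1) * (i.Mh * i.P' 0)) := Nat.mul_le_mul hpow h40
  exact_mod_cast hnat

omit [Nonempty (Fin N)] in
/-- ★ **AN AVERAGED FINE BOND HAS AN IN-BOX LIFT**: `q_ι(f) ≠ 0 ⟹ f = ⟨0 + x, κ(ι)⟩` for some integer point `x` of the double box `[Lʲz_ι, Lʲz_ι + (Lʲ−1)𝟙 + Lʲe_κ]`
(t2s-1's window reading `src_eq_winBase_of_qK_ne_zero`, moved to the representative `z_ι` by a period vector). [cite: Balaban1984PropagatorsI, (1.18) p.20; Balaban1985Averaging, p.24 (after (43))] -/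
theorem exists_inBox_of_qK_ne_zero {ι : IBondY i} {f : FBondY i} (hq : qK i ι f ≠ 0) :
    ∃ x : LSite (d + 1), InBox (loK (ℓ + 1) (ι.1.1 : ℕ) (zSrc i ι)) (bondHiK (ℓ + 1) (ι.1.1 : ℕ) (zSrc i ι) ι.1.2.dir) x ∧
      f = ⟨transl (0 : Site (PV d ℓ i.m i.K hd hL) 0) x, ι.1.2.dir⟩ := by
  have hL1 : 1 ≤ ℓ + 1 := Nat.succ_pos ℓ
  have hj : (ι.1.1 : ℕ) ≤ i.m + i.K := (lvl_le' i ι).trans i.hk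
  obtain ⟨t, ht⟩ := src_eq_winBase_of_qK_ne_zero i hq
  have hdir : ι.1.2.dir = f.dir := dir_eq_of_qK_ne_zero i hq
  set y : LSite (d + 1) := rel (0 : Site (PV d ℓ i.m i.K hd hL) 0) f.src with hy
  set w := B9Eq316AveragingTransposeZd.winBase (ℓ + 1) (ι.1.1 : ℕ) y f.dir t with hw
  -- `w` and `z_ι` label the same torus block: they differ by a period vector of the level-`j` lattice
  set Pj : ℕ := (PV d ℓ i.m i.K hd hL).sitesPerDir (ι.1.1 : ℕ) with hPj
  have hzw : ∀ ν, ((Pj : ℕ) : ℤ) ∣ zSrc i ι ν - w ν := fun ν => by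
    have h := congrFun ((transl_zero_zSrc i ι).trans ht) ν
    rw [transl_apply, transl_apply] at h
    exact (ZMod.intCast_eq_intCast_iff_dvd_sub _ _ _).1 (add_left_cancel h).symm
  set v : LSite (d + 1) := fun ν => (zSrc i ι ν - w ν) / ((Pj : ℕ) : ℤ) with hv
  have hzv : ∀ ν, zSrc i ι ν = w ν + ((Pj : ℕ) : ℤ) * v ν := fun ν => by
    rw [hv]; simp only; rw [Int.mul_ediv_cancel' (hzw ν)]; ring
  have hN0 : ((((PV d ℓ i.m i.K hd hL).sitesPerDir 0 : ℕ) : ℤ)) = (((ℓ + 1 : ℕ) : ℤ)) ^ (ι.1.1 : ℕ) * ((Pj : ℕ) : ℤ) := by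
    rw [hPj, B9B8KnitBondAvgDictionary.sitesPerDir_zero_eq_mul (m := i.m) (K := i.K) (hd := hd) (hL := hL) hj]; push_cast; ring
  set x : LSite (d + 1) := fun ν => y ν + ((((PV d ℓ i.m i.K hd hL).sitesPerDir 0 : ℕ) : ℤ)) * v ν with hx
  have hwin := B9Eq316AveragingTransposeZd.inBox_winBase hL1 (ι.1.1 : ℕ) y f.dir t
  rw [← hw] at hwin
  refine ⟨x, fun ν => ?_, ?_⟩
  · obtain ⟨h1, h2⟩ := hwin ν
    have elo : loK (ℓ + 1) (ι.1.1 : ℕ) (zSrc i ι) ν = loK (ℓ + 1) (ι.1.1 : ℕ) w ν + ((((PV d ℓ i.m i.K hd hL).sitesPerDir 0 : ℕ) : ℤ)) * v ν := by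
      simp only [loK, hzv ν, hN0]; push_cast; ring
    have ehi : bondHiK (ℓ + 1) (ι.1.1 : ℕ) (zSrc i ι) ι.1.2.dir ν =
        bondHiK (ℓ + 1) (ι.1.1 : ℕ) w f.dir ν + ((((PV d ℓ i.m i.K hd hL).sitesPerDir 0 : ℕ) : ℤ)) * v ν := by
      simp only [bondHiK, hzv ν, hN0, hdir]; push_cast; ring
    have exν : x ν = y ν + ((((PV d ℓ i.m i.K hd hL).sitesPerDir 0 : ℕ) : ℤ)) * v ν := rfl
    rw [elo, ehi, exν]
    exact ⟨by linarith, by linarith⟩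
  · have hsrc : transl (0 : Site (PV d ℓ i.m i.K hd hL) 0) x = f.src := by
      have h0 : transl (0 : Site (PV d ℓ i.m i.K hd hL) 0) x = transl (0 : Site (PV d ℓ i.m i.K hd hL) 0) y := by
        funext ν
        rw [transl_apply, transl_apply, hx]
        push_cast
        rw [ZMod.natCast_self, zero_mul, add_zero]
      rw [h0, hy, transl_rel]
    cases f
    simp only at hsrc hdir
    rw [hsrc, hdir]

/-- the block centre of `ι` read on `ℤ^{d+1}`: `embIter j ι₋ = 0 + (Lʲz_ι + (Lʲ−1)∕2·𝟙)`. [cite: Balaban1985BackgroundPropagators, (3.12) p.392 («the centre y of the block»), bookkeeping] -/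
theorem embIter_src_eq (ι : IBondY i) :
    embIter (ι.1.1 : ℕ) ι.1.2.src = transl (0 : Site (PV d ℓ i.m i.K hd hL) 0)
      (fun ν => (((ℓ + 1) ^ (ι.1.1 : ℕ) : ℕ) : ℤ) * zSrc i ι ν + ((((ℓ + 1) ^ (ι.1.1 : ℕ) - 1) / 2 : ℕ) : ℤ)) := by
  have hj : (ι.1.1 : ℕ) ≤ i.m + i.K := (lvl_le' i ι).trans i.hk
  have h := embIter_transl_zero i hj (zSrc i ι)
  rw [transl_zero_zSrc] at h
  exact h

/-- ★★ **`qT_Y ι f = W·U(Γ^{taxi}_{c→x₀})·T^{box}_ι(f)` WITH `‖W − 1‖ ≤ 4(d+2)²α₀′`, AT EVERY LEVEL STRUCTURE.**  For every member background `U` of the class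
`(bg9KP …).Reg335 c₀ α₀` (`G ≤ U(N)` unit-bounded, `c₀ ≤ 10`, `0 ≤ Mα₀`, `K_pl(Mα₀)·L⁴ < α₀′`), an index bond `ι` (block centre `c = embIter j ι₋`, corner `x₀ = Lʲz_ι`)
and a fine bond `f` seen by `ι` (`q_ι(f) ≠ 0`): print's transporter `qT parBY U ι f = U(Γ^{taxi}_{c→f₋})` ([4] (3.12), (3.40)), divided by `U(Γ^{taxi}_{c→x₀})·T^{box}_ι(f)`, is the
holonomy of the closed contour `c → f₋ → x₀ → c` inside the double box, within `4(d+2)²α₀′` of `1` — J-B's loop lemma at the retraction `Û_ι` (globally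
`α₀′L^{−2j}`-regular by [5] Prop. 2, F5), locality of the three holonomies inside the box. The every-level twin of J-B's `norm_qT_parBY_rebase_sub_one_le`.
[cite: Balaban1985BackgroundPropagators, (3.12) p.392, (3.40) p.397, (3.35) p.396; Balaban1985Averaging, pp.24–25, (141) p.39, Prop. 2 p.26] -/
theorem norm_qT_parBY_boxT_rebase_sub_one_le (hG1 : ∀ u : (Matrix (Fin N) (Fin N) ℂ)ˣ, u ∈ G → ‖(u : Matrix (Fin N) (Fin N) ℂ)‖ ≤ 1)
    (hGU : G ≤ unitaryUnits (Matrix (Fin N) (Fin N) ℂ))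
    {U : CfgY (Matrix (Fin N) (Fin N) ℂ) i} {c₀ α₀ : ℝ} (hc : c₀ ≤ 10) (hMα : 0 ≤ (kGeo i).M * α₀)
    (hreg : (bg9KP (Matrix (Fin N) (Fin N) ℂ) G i).Reg335 c₀ α₀ U) {α₀' : ℝ} (hα' : 0 < α₀')
    (hK : Kpl i ((kGeo i).M * α₀) * (kGeo i).L ^ 4 < α₀') {ι : IBondY i} {f : FBondY i} (hq : qK i ι f ≠ 0) :
    ‖((qT i (parBY i) U ι f *
        (parTaxiV U (embIter (ι.1.1 : ℕ) ι.1.2.src) (transl (0 : Site (PV d ℓ i.m i.K hd hL) 0) (loK (ℓ + 1) (ι.1.1 : ℕ) (zSrc i ι))) *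
          boxT i U ι f)⁻¹ : (Matrix (Fin N) (Fin N) ℂ)ˣ) : Matrix (Fin N) (Fin N) ℂ) - 1‖ ≤ 4 * ((d : ℝ) + 2) ^ 2 * α₀' := by
  classical
  letI : CStarAlgebra (Matrix (Fin N) (Fin N) ℂ) := {}
  have hL1 : 1 ≤ ℓ + 1 := Nat.succ_pos ℓ
  have hU : ∀ μ x, U μ x ∈ unitaryUnits (Matrix (Fin N) (Fin N) ℂ) := fun μ x => hGU (mem_of_reg335P (G := G) i hreg μ x)
  have hVu : ∀ x μ, retrY i U ι x μ ∈ unitaryUnits (Matrix (Fin N) (Fin N) ℂ) := retrY_mem i hU ι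
  have h52 : pdev (retrY i U ι) < α₀' * ((((ℓ + 1 : ℕ) : ℝ) ^ (ι.1.1 : ℕ))⁻¹) ^ 2 := pdev_retract_bond_lt i hG1 U hc hMα hreg hK ι
  have hreg17 : Reg17 (ℓ + 1) (ι.1.1 : ℕ) (fun _ => (Set.univ : Set (LSite (d + 1)))) α₀' (retrY i U ι) :=
    reg17_univ_of_pdev hL1 hα'.le hVu (by exact_mod_cast h52)
  obtain ⟨x, hx, hf⟩ := exists_inBox_of_qK_ne_zero i hq
  subst hf
  set lo := loK (ℓ + 1) (ι.1.1 : ℕ) (zSrc i ι) with hlo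
  set hi := bondHiK (ℓ + 1) (ι.1.1 : ℕ) (zSrc i ι) ι.1.2.dir with hhi
  set P : ℤ := ((ℓ : ℤ) + 1) ^ (ι.1.1 : ℕ) with hP
  set cN : ℕ := ((ℓ + 1) ^ (ι.1.1 : ℕ) - 1) / 2 with hcN
  have hPnat : (((ℓ + 1) ^ (ι.1.1 : ℕ) : ℕ) : ℤ) = P := by rw [hP]; push_cast; ring
  set cv : LSite (d + 1) := fun ν => (((ℓ + 1) ^ (ι.1.1 : ℕ) : ℕ) : ℤ) * zSrc i ι ν + ((cN : ℕ) : ℤ) with hcv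
  have hcvν : ∀ ν, cv ν = P * zSrc i ι ν + ((cN : ℕ) : ℤ) := fun ν => by rw [hcv]; simp only [hPnat]
  have hcentre : embIter (ι.1.1 : ℕ) ι.1.2.src = transl (0 : Site (PV d ℓ i.m i.K hd hL) 0) cv := embIter_src_eq i ι
  -- sizes: `2c ≤ P − 1`, `4P ≤ N₀`
  have hcN2 : 2 * ((cN : ℕ) : ℤ) ≤ P - 1 := by
    have h1 : 2 * cN ≤ (ℓ + 1) ^ (ι.1.1 : ℕ) - 1 := Nat.mul_div_le _ _
    have h2 : 1 ≤ (ℓ + 1) ^ (ι.1.1 : ℕ) := Nat.one_le_pow _ _ hL1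
    rw [← hPnat]; omega
  have hcN0 : (0 : ℤ) ≤ ((cN : ℕ) : ℤ) := by positivity
  have h4N : 4 * P ≤ ((((PV d ℓ i.m i.K hd hL).sitesPerDir 0 : ℕ) : ℤ)) := by
    have h := four_mul_pow_le_sitesPerDir i ι
    push_cast at h
    rw [← hP] at h
    exact h
  have hP0 : (0 : ℤ) < P := by positivity
  -- both `x` and the centre lie in the double box, all displacements are short
  have hlo_in : InBox lo hi lo := lo_inBox i ι
  have hc_in : InBox lo hi cv := fun ν => by
    rw [hcvν ν]
    simp only [hlo, hhi, loK, bondHiK]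
    push_cast
    rw [← hP]
    constructor
    · nlinarith
    · split_ifs <;> nlinarith
  have hbox : ∀ {y : LSite (d + 1)}, InBox lo hi y → ∀ ν, lo ν ≤ y ν ∧ y ν ≤ lo ν + 2 * P - 1 := by
    intro y hy ν
    obtain ⟨h1, h2⟩ := hy ν
    simp only [hlo, hhi, loK, bondHiK] at h1 h2 ⊢
    push_cast at h1 h2 ⊢
    rw [← hP] at h1 h2 ⊢
    refine ⟨h1, ?_⟩
    split_ifs at h2 <;> linarith
  have hsmall : ∀ {y : LSite (d + 1)}, InBox lo hi y → ∀ ν, 2 * |y ν - cv ν| < ((((PV d ℓ i.m i.K hd hL).sitesPerDir 0 : ℕ) : ℤ)) := by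
    intro y hy ν
    obtain ⟨h1, h2⟩ := hbox hy ν
    have hl : lo ν = P * zSrc i ι ν := by simp only [hlo, loK]; push_cast; rw [hP]
    have : |y ν - cv ν| < 2 * P := by
      rw [abs_lt, hcvν ν]; rw [hl] at h1 h2; constructor <;> linarith
    linarith
  -- the three readings on `ℤ^{d+1}`
  have eY : qT i (parBY i) U ι ⟨transl (0 : Site (PV d ℓ i.m i.K hd hL) 0) x, ι.1.2.dir⟩ =
      hol (liftCfg U) cv ((List.finRange (d + 1)).flatMap fun ν => seg ν ((x - cv) ν)) := by
    show parTaxiV U (embIter (ι.1.1 : ℕ) ι.1.2.src) (transl (0 : Site (PV d ℓ i.m i.K hd hL) 0) x) = _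
    rw [hcentre, parTaxiV_transl i U cv x (hsmall hx)]
    rfl
  have eT : parTaxiV U (embIter (ι.1.1 : ℕ) ι.1.2.src) (transl (0 : Site (PV d ℓ i.m i.K hd hL) 0) lo) =
      hol (liftCfg U) cv ((List.finRange (d + 1)).flatMap fun ν => seg ν ((lo - cv) ν)) := by
    rw [hcentre, parTaxiV_transl i U cv lo (hsmall hlo_in)]
    rfl
  have eC : boxT i U ι ⟨transl (0 : Site (PV d ℓ i.m i.K hd hL) 0) x, ι.1.2.dir⟩ = hol (liftCfg U) lo (treeWord (x - lo)) :=
    boxT_eq_of_inBox i U ι hx _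
  -- locality: on contours inside the box, `U♯` may be replaced by the retraction `Û_ι`
  have hag : AgreeOn lo hi (liftCfg U) (retrY i U ι) := agreeOn_liftCfg_retrY i U ι
  have hend : ∀ {y : LSite (d + 1)}, InBox lo hi y → ∀ μ ∈ List.finRange (d + 1), lo μ ≤ cv μ + (y - cv) μ ∧ cv μ + (y - cv) μ ≤ hi μ :=
    fun {y} hy μ _ => by rw [Pi.sub_apply, add_sub_cancel]; exact hy μ
  have lY : hol (liftCfg U) cv ((List.finRange (d + 1)).flatMap fun ν => seg ν ((x - cv) ν)) =
      hol (retrY i U ι) cv ((List.finRange (d + 1)).flatMap fun ν => seg ν ((x - cv) ν)) :=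
    hol_flatMap_seg_congr hag (x - cv) _ (List.nodup_finRange _) cv hc_in (hend hx)
  have lT : hol (liftCfg U) cv ((List.finRange (d + 1)).flatMap fun ν => seg ν ((lo - cv) ν)) =
      hol (retrY i U ι) cv ((List.finRange (d + 1)).flatMap fun ν => seg ν ((lo - cv) ν)) :=
    hol_flatMap_seg_congr hag (lo - cv) _ (List.nodup_finRange _) cv hc_in (hend hlo_in)
  have lC : hol (liftCfg U) lo (treeWord (x - lo)) = hol (retrY i U ι) lo (treeWord (x - lo)) :=
    hol_treeWord_congr hag lo (x - lo) hlo_in (by rw [add_sub_cancel]; exact hx)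
  rw [eY, eT, eC, lY, lT, lC]
  have h := norm_loop_sub_one_le (ℓ + 1) hL1 hα' hVu hreg17 (zSrc i ι) ι.1.2.dir hc_in hx
  refine h.trans (le_of_eq ?_)
  push_cast
  ring

/-- ★ **THE CORNER-TREE FLAT AVERAGE IS PRINT's CENTRE-TAXI AVERAGE RE-BASED BY `T_ι = U(Γ^{taxi}_{c→x₀})⁻¹`, UP TO `8(d+2)²α₀′·Σ_f q_ι(f)‖a f‖`** on (3.35):
`‖Σ_f q_ι(f)·R(T^{box}_ι(f))a(f) − R(T_ι)((Q_Y(U)a)(ι))‖ ≤ 8(d+2)²·α₀′·Σ_f q_ι(f)·‖a(f)‖` (the loop lemma above, `‖R(W)Z − Z‖ ≤ 2‖W − 1‖‖Z‖`, `R` isometric at unitaries).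
[cite: Balaban1985BackgroundPropagators, (3.12)–(3.13) p.392, (3.40) p.397, (3.35) p.396; Balaban1985Averaging, pp.24–25] -/
theorem norm_boxAvg_sub_R_QY_parBY_le (hG1 : ∀ u : (Matrix (Fin N) (Fin N) ℂ)ˣ, u ∈ G → ‖(u : Matrix (Fin N) (Fin N) ℂ)‖ ≤ 1)
    (hGU : G ≤ unitaryUnits (Matrix (Fin N) (Fin N) ℂ))
    {U : CfgY (Matrix (Fin N) (Fin N) ℂ) i} {c₀ α₀ : ℝ} (hc : c₀ ≤ 10) (hMα : 0 ≤ (kGeo i).M * α₀)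
    (hreg : (bg9KP (Matrix (Fin N) (Fin N) ℂ) G i).Reg335 c₀ α₀ U) {α₀' : ℝ} (hα' : 0 < α₀')
    (hK : Kpl i ((kGeo i).M * α₀) * (kGeo i).L ^ 4 < α₀') (a : FBondY i → Matrix (Fin N) (Fin N) ℂ) (ι : IBondY i) :
    ‖∑ f, ((qK i ι f : ℝ) : ℂ) • conjR (boxT i U ι f) (a f) -
        R (parTaxiV U (embIter (ι.1.1 : ℕ) ι.1.2.src) (transl (0 : Site (PV d ℓ i.m i.K hd hL) 0) (loK (ℓ + 1) (ι.1.1 : ℕ) (zSrc i ι))))⁻¹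
          (QY i (parBY i) U a ι)‖ ≤ 8 * ((d : ℝ) + 2) ^ 2 * α₀' * ∑ f, qK i ι f * ‖a f‖ := by
  classical
  letI : CStarAlgebra (Matrix (Fin N) (Fin N) ℂ) := {}
  have hU : ∀ μ x, U μ x ∈ unitaryUnits (Matrix (Fin N) (Fin N) ℂ) := fun μ x => hGU (mem_of_reg335P (G := G) i hreg μ x)
  set Tc := parTaxiV U (embIter (ι.1.1 : ℕ) ι.1.2.src) (transl (0 : Site (PV d ℓ i.m i.K hd hL) 0) (loK (ℓ + 1) (ι.1.1 : ℕ) (zSrc i ι))) with hTc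
  have hTc : Tc ∈ unitaryUnits (Matrix (Fin N) (Fin N) ℂ) :=
    parTaxiV_mem hU (embIter (ι.1.1 : ℕ) ι.1.2.src) (transl (0 : Site (PV d ℓ i.m i.K hd hL) 0) (loK (ℓ + 1) (ι.1.1 : ℕ) (zSrc i ι)))
  have hY : ∀ f, qT i (parBY i) U ι f ∈ unitaryUnits (Matrix (Fin N) (Fin N) ℂ) := fun f =>
    parTaxiV_mem hU (embIter (ι.1.1 : ℕ) ι.1.2.src) f.src
  have hB : ∀ f, boxT i U ι f ∈ unitaryUnits (Matrix (Fin N) (Fin N) ℂ) := fun f => boxT_mem i hU ι f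
  -- `R(T_ι)` pulled inside def-Y's transported lift
  have hQY : R Tc⁻¹ (QY i (parBY i) U a ι) = ∑ f, ((qK i ι f : ℝ) : ℂ) • R Tc⁻¹ (R (qT i (parBY i) U ι f) (a f)) := by
    show R Tc⁻¹ (∑ f, ((qK i ι f : ℝ) : ℂ) • R (qT i (parBY i) U ι f) (a f)) = _
    rw [R_finset_sum]
    exact Finset.sum_congr rfl fun f _ => R_smul _ _ _
  -- termwise: the loop `W = qT_Y·(T_c·T^{box})⁻¹` is within `4(d+2)²α₀′` of `1`
  have hterm : ∀ f, ‖((qK i ι f : ℝ) : ℂ) • (conjR (boxT i U ι f) (a f) - R Tc⁻¹ (R (qT i (parBY i) U ι f) (a f)))‖ ≤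
      qK i ι f * (8 * ((d : ℝ) + 2) ^ 2 * α₀' * ‖a f‖) := by
    intro f
    rw [norm_smul, Complex.norm_real, Real.norm_of_nonneg (qK_nonneg i ι f)]
    by_cases hq : qK i ι f = 0
    · rw [hq, zero_mul, zero_mul]
    refine mul_le_mul_of_nonneg_left ?_ (qK_nonneg i ι f)
    set V := Tc * boxT i U ι f with hV
    set W := qT i (parBY i) U ι f * V⁻¹ with hW
    have hVmem : V ∈ unitaryUnits (Matrix (Fin N) (Fin N) ℂ) := Subgroup.mul_mem _ hTc (hB f)
    have hWmem : W ∈ unitaryUnits (Matrix (Fin N) (Fin N) ℂ) := Subgroup.mul_mem _ (hY f) (Subgroup.inv_mem _ hVmem)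
    have hW1 : ‖(W : Matrix (Fin N) (Fin N) ℂ) - 1‖ ≤ 4 * ((d : ℝ) + 2) ^ 2 * α₀' :=
      norm_qT_parBY_boxT_rebase_sub_one_le i hG1 hGU hc hMα hreg hα' hK hq
    have hqT : qT i (parBY i) U ι f = W * V := by rw [hW, inv_mul_cancel_right]
    have e1 : R Tc⁻¹ (R V (a f)) = conjR (boxT i U ι f) (a f) := by rw [conjR_eq_R, ← B9Eq39Adjoint.R_mul, hV, inv_mul_cancel_left]
    have e2 : R Tc⁻¹ (R W (R V (a f))) = R Tc⁻¹ (R (qT i (parBY i) U ι f) (a f)) := by rw [← B9Eq39Adjoint.R_mul W V, ← hqT]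
    have e : conjR (boxT i U ι f) (a f) - R Tc⁻¹ (R (qT i (parBY i) U ι f) (a f)) = R Tc⁻¹ (R V (a f) - R W (R V (a f))) := by
      rw [R_sub, e1, e2]
    rw [e]
    calc ‖R Tc⁻¹ (R V (a f) - R W (R V (a f)))‖ ≤ ‖R V (a f) - R W (R V (a f))‖ :=
          norm_R_le_of_mem_unitaryUnits (Subgroup.inv_mem _ hTc) _
      _ = ‖R W (R V (a f)) - R V (a f)‖ := norm_sub_rev _ _
      _ ≤ 2 * ‖(W : Matrix (Fin N) (Fin N) ℂ) - 1‖ * ‖R V (a f)‖ := norm_R_sub_self_le (unitaryUnits_le_U1 hWmem) _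
      _ ≤ 2 * (4 * ((d : ℝ) + 2) ^ 2 * α₀') * ‖a f‖ := by
          gcongr
          exact norm_R_le_of_mem_unitaryUnits hVmem _
      _ = 8 * ((d : ℝ) + 2) ^ 2 * α₀' * ‖a f‖ := by ring
  rw [hQY, ← Finset.sum_sub_distrib]
  simp_rw [← smul_sub]
  calc ‖∑ f, ((qK i ι f : ℝ) : ℂ) • (conjR (boxT i U ι f) (a f) - R Tc⁻¹ (R (qT i (parBY i) U ι f) (a f)))‖
      ≤ ∑ f, ‖((qK i ι f : ℝ) : ℂ) • (conjR (boxT i U ι f) (a f) - R Tc⁻¹ (R (qT i (parBY i) U ι f) (a f)))‖ := norm_sum_le _ _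
    _ ≤ ∑ f, qK i ι f * (8 * ((d : ℝ) + 2) ^ 2 * α₀' * ‖a f‖) := Finset.sum_le_sum fun f _ => hterm f
    _ = ∑ f, 8 * ((d : ℝ) + 2) ^ 2 * α₀' * (qK i ι f * ‖a f‖) := Finset.sum_congr rfl fun f _ => by ring
    _ = 8 * ((d : ℝ) + 2) ^ 2 * α₀' * ∑ f, qK i ι f * ‖a f‖ := by rw [← Finset.mul_sum]

end Rebase

/-! ## §5 ★★★ The display: the knit letter vs print's centre-taxi averaging, row by row, on (3.35) -/

section Display

open scoped Matrix Matrix.Norms.L2Operator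

variable {N : ℕ} [Nonempty (Fin N)] (i : KIdx d ℓ hd hL b₀ b₁) {G : Subgroup (Matrix (Fin N) (Fin N) ℂ)ˣ}

/-- ★★★ **THE KNIT LETTER `Q(U)` OF (3.115) IS ROW-WISE CLOSE TO PRINT's CENTRE-TAXI AVERAGING `Q_Y(U)` OF (3.12), UP TO THE ROW-WISE UNITARY RE-BASING
`T_ι = U(Γ^{taxi}_{c→x₀})⁻¹`, ON THE CLASS (3.35)** — for every member background `U` of `(bg9KP … G i).Reg335 c₀ α₀` (any level structure; `G ≤ U(N)` unit-bounded,
`c₀ ≤ 10`, `0 ≤ Mα₀`), x-free numerics `0 < α₀′ ≤ α_Q(d+1,L)`, `K_pl(Mα₀)·L⁴ < α₀′`, every bond function `a` and every index bond `ι`: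
`‖(Q(U)a)(ι) − R(T_ι)((Q_Y(U)a)(ι))‖ ≤ α₀′·Σ_f (K(d+1,L)·boxK ι f + 8(d+2)²·q_ι(f))·‖a(f)‖`, `T_ι = (parTaxiV U (embIter j ι₋) (0 + Lʲz_ι))⁻¹` unitary,
with the mass-bounded, level-windowed kernels `boxK` (§1) and `qK` (def-Y).  (The `hclose` display of row 17 at `𝔮 := QknitY`, in row form; dag-n06-j's
`B9Eq315QYSizeWeightedL2Y` converts it to the `trIP` currency.) [cite: Balaban1985BackgroundPropagators, (3.12)–(3.13) p.392, (3.14)–(3.15) p.393, (3.115) p.419, (3.35) p.396, (3.40) p.397; Balaban1985Averaging, (139)–(147) pp.39–40, pp.24–25, Prop. 2 p.26] -/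
theorem norm_QknitY_sub_R_QY_parBY_le (hG1 : ∀ u : (Matrix (Fin N) (Fin N) ℂ)ˣ, u ∈ G → ‖(u : Matrix (Fin N) (Fin N) ℂ)‖ ≤ 1)
    (hGU : G ≤ unitaryUnits (Matrix (Fin N) (Fin N) ℂ))
    {U : CfgY (Matrix (Fin N) (Fin N) ℂ) i} {c₀ α₀ : ℝ} (hc : c₀ ≤ 10) (hMα : 0 ≤ (kGeo i).M * α₀)
    (hreg : (bg9KP (Matrix (Fin N) (Fin N) ℂ) G i).Reg335 c₀ α₀ U) {α₀' : ℝ} (hα' : 0 < α₀') (hαQ : α₀' ≤ alphaQ (d + 1) (ℓ + 1))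
    (hK : Kpl i ((kGeo i).M * α₀) * (kGeo i).L ^ 4 < α₀') (a : FBondY i → Matrix (Fin N) (Fin N) ℂ) (ι : IBondY i) :
    ‖QknitY i U a ι -
        R (parTaxiV U (embIter (ι.1.1 : ℕ) ι.1.2.src) (transl (0 : Site (PV d ℓ i.m i.K hd hL) 0) (loK (ℓ + 1) (ι.1.1 : ℕ) (zSrc i ι))))⁻¹
          (QY i (parBY i) U a ι)‖ ≤
      α₀' * ∑ f, (kCol (d + 1) (ℓ + 1) * boxK i ι f + 8 * ((d : ℝ) + 2) ^ 2 * qK i ι f) * ‖a f‖ := by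
  have h1 := norm_QknitY_sub_boxAvg_le i hG1 hGU hc hMα hreg hα' hαQ hK a ι
  have h2 := norm_boxAvg_sub_R_QY_parBY_le i hG1 hGU hc hMα hreg hα' hK a ι
  set q := QknitY i U a ι with hq
  set avg := ∑ f, ((qK i ι f : ℝ) : ℂ) • conjR (boxT i U ι f) (a f) with havg
  set r := R (parTaxiV U (embIter (ι.1.1 : ℕ) ι.1.2.src) (transl (0 : Site (PV d ℓ i.m i.K hd hL) 0) (loK (ℓ + 1) (ι.1.1 : ℕ) (zSrc i ι))))⁻¹
    (QY i (parBY i) U a ι) with hr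
  have hsplit : q - r = (q - avg) + (avg - r) := (sub_add_sub_cancel q avg r).symm
  calc ‖q - r‖ = ‖(q - avg) + (avg - r)‖ := by rw [← hsplit]
    _ ≤ ‖q - avg‖ + ‖avg - r‖ := norm_add_le _ _
    _ ≤ kCol (d + 1) (ℓ + 1) * α₀' * ∑ f, boxK i ι f * ‖a f‖ + 8 * ((d : ℝ) + 2) ^ 2 * α₀' * ∑ f, qK i ι f * ‖a f‖ := add_le_add h1 h2
    _ = α₀' * ∑ f, (kCol (d + 1) (ℓ + 1) * boxK i ι f + 8 * ((d : ℝ) + 2) ^ 2 * qK i ι f) * ‖a f‖ := by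
        rw [Finset.mul_sum, Finset.mul_sum, Finset.mul_sum, ← Finset.sum_add_distrib]
        exact Finset.sum_congr rfl fun f _ => by ring

omit [Nonempty (Fin N)] in
/-- the re-basing `T_ι` is unitary at a member of the class (so `R(T_ι)` preserves every unitarily invariant norm — dag-n06-j's `trIP_w_eq_of_rowRebase`).
[cite: Balaban1985BackgroundPropagators, p.390 («with values in G»), (3.40) p.397, bookkeeping] -/
theorem rebase_mem_unitary (hGU : G ≤ unitaryUnits (Matrix (Fin N) (Fin N) ℂ))
    {U : CfgY (Matrix (Fin N) (Fin N) ℂ) i} {c₀ α₀ : ℝ} (hreg : (bg9KP (Matrix (Fin N) (Fin N) ℂ) G i).Reg335 c₀ α₀ U) (ι : IBondY i) :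
    (parTaxiV U (embIter (ι.1.1 : ℕ) ι.1.2.src) (transl (0 : Site (PV d ℓ i.m i.K hd hL) 0) (loK (ℓ + 1) (ι.1.1 : ℕ) (zSrc i ι))))⁻¹ ∈
      unitaryUnits (Matrix (Fin N) (Fin N) ℂ) := by
  have hU : ∀ μ x, U μ x ∈ unitaryUnits (Matrix (Fin N) (Fin N) ℂ) := fun μ x => hGU (mem_of_reg335P (G := G) i hreg μ x)
  exact Subgroup.inv_mem _ (parTaxiV_mem hU (embIter (ι.1.1 : ℕ) ι.1.2.src)
    (transl (0 : Site (PV d ℓ i.m i.K hd hL) 0) (loK (ℓ + 1) (ι.1.1 : ℕ) (zSrc i ι))))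

omit [Nonempty (Fin N)] in
/-- the re-basing `T_ι` is `G`-valued at a `G`-valued `U` (in particular `SU(N)`-valued at the record). [cite: Balaban1985BackgroundPropagators, p.390, bookkeeping] -/
theorem rebase_mem {U : CfgY (Matrix (Fin N) (Fin N) ℂ) i} (hU : ∀ μ x, U μ x ∈ G) (ι : IBondY i) :
    (parTaxiV U (embIter (ι.1.1 : ℕ) ι.1.2.src) (transl (0 : Site (PV d ℓ i.m i.K hd hL) 0) (loK (ℓ + 1) (ι.1.1 : ℕ) (zSrc i ι))))⁻¹ ∈ G := by
  exact Subgroup.inv_mem _ (parTaxiV_mem hU (embIter (ι.1.1 : ℕ) ι.1.2.src)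
    (transl (0 : Site (PV d ℓ i.m i.K hd hL) 0) (loK (ℓ + 1) (ι.1.1 : ℕ) (zSrc i ι))))

end Display


end Literature.MathematicalPhysics.QuantumFieldTheory.Balaban1983to89.B9Eq3115KnitLetterYRowCloseness
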